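import Literature.Probability.LatticeModels.TemperleyLiebCapContract
import HarnessLib

/-!
# Every link pattern carries a nearest-neighbour chord: the planar module is the sum of the images of the cap insertions, and the inductive spanning criterion («TL-CAP-SPAN»)

Topic `Literature/Probability/LatticeModels`; a rider on `TemperleyLiebCapContract.lean` («TL-CAP-CONTRACT»: `capIns j`, `contractSucc j`, `capIns_contractSucc`, `capInsL`).
The elementary fact of the diagram calculus that a system of non-intersecting half-loops on a line has an innermost one joining two NEIGHBOURING sites
(Pearce–Rittenberg–de Gier–Nienhuis 2002, §2: the link patterns) gives, in the lineage's coordinates: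

* ★ `LinkPattern.exists_adjacent` — every link pattern of `n + 2 ≥ 2` sites pairs some `j` with `j + 1` (a chord of minimal width is a nearest-neighbour chord, by planarity);
* `LinkPattern.eq_capIns_contractSucc` — a pattern pairing `j` with `j+1` IS the cap insertion at `j` of its contraction; ★ `LinkPattern.exists_eq_capIns` — every link pattern of
  `n + 2` sites is `capIns j P` for some `j` and some pattern `P` of `n` sites;
* ★★ `eq_top_of_forall_range_capInsL_le` / `iSup_range_capInsL_eq_top` — **THE PLANAR MODULE OF `n + 2` SITES IS THE SUM OF THE IMAGES OF THE `n + 1` CAP INSERTIONS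
  `capInsL j : V_n → V_{n+2}`**;
* ★★★ `span_eq_top_of_capInsL_mem_span` — **THE INDUCTIVE SPANNING CRITERION**: if for every `j` a family `g j` of vectors SPANS `V_n` and the cap insertions `capInsL j (g j k)`
  all lie in the span of a family `f` of vectors of `V_{n+2}`, then `f` spans `V_{n+2}` — the algebraic skeleton of the lane's induction on the number of marked points for
  boundary span (HOME `FINDING-BSPAN-TOWER-IDENTITY.md` §4 (S3): `g j` = laws of `(2n−2)`-marked domains with an insertion site in gap `j`, `f` = laws of `2n`-marked domains,
  and `capInsL j (law D̂) = law(D̂⁺ ⊕ h) − law(D̂⁺)` by the one-hexagon decomposition F1).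

## References
* P. A. Pearce, V. Rittenberg, J. de Gier, B. Nienhuis, *Temperley–Lieb stochastic processes*, J. Phys. A 35 (2002) L661–L668, §2 (link patterns = non-intersecting
  half-loops; the monoid move).

## Mathlib / tree
Tree: `TemperleyLiebCapContract.lean` (`LinkPattern.capIns`, `contractSucc`, `capIns_contractSucc`, `capInsL`, `capInsL_single`), `TemperleyLiebLinkModule.lean`
(`connectSucc_of_partner_eq`), `TemperleyLiebLinkPatterns.lean` (`PerfectMatching`, `partner_partner`, `partner_ne`, `partner_inj`, `IsNonCrossing`). Mathlib:
`Finset.exists_min_image`, `Finsupp.induction_linear`, `Submodule.span_le`, `LinearMap.mem_range`.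
-/

namespace Literature.Probability.LatticeModels.TemperleyLieb

open Function

namespace LinkPattern

variable {n : ℕ}

/-- ★ **every link pattern of at least two sites has a nearest-neighbour chord** (a chord `{a, Q a}`, `a < Q a`, of minimal width: by planarity the partner of `a + 1` lies inside it,
so minimality forces `Q a = a + 1`). [cite: PearceRittenbergDeGierNienhuis2002, §2 (non-intersecting half-loops)] -/
theorem exists_adjacent (Q : LinkPattern (n + 1 + 1)) : ∃ j : Fin (n + 1), Q.1.partner (Fin.castSucc j) = j.succ := by
  classical
  -- a site below its partner exists
  have hne : (Finset.univ.filter fun a : Fin (n + 1 + 1) => a < Q.1.partner a).Nonempty := by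
    let x : Fin (n + 1 + 1) := 0
    rcases lt_or_gt_of_ne (Q.1.partner_ne x).symm with h | h
    · exact ⟨x, Finset.mem_filter.2 ⟨Finset.mem_univ _, h⟩⟩
    · exact ⟨Q.1.partner x, Finset.mem_filter.2 ⟨Finset.mem_univ _, by rw [Q.1.partner_partner]; exact h⟩⟩
  obtain ⟨a, haS, hmin⟩ := Finset.exists_min_image _ (fun a => (Q.1.partner a).val - a.val) hne
  have ha : a < Q.1.partner a := (Finset.mem_filter.1 haS).2
  rw [Fin.lt_def] at ha
  -- the width is `1`
  have hw : (Q.1.partner a).val = a.val + 1 := by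
    by_contra hw
    have h2 : a.val + 2 ≤ (Q.1.partner a).val := by omega
    let b : Fin (n + 1 + 1) := ⟨a.val + 1, by have := (Q.1.partner a).2; omega⟩
    have hab : a < b := by show a.val < a.val + 1; omega
    have hbc : b < Q.1.partner a := by show a.val + 1 < (Q.1.partner a).val; omega
    obtain ⟨hb1, hb2⟩ := Q.2 a b (Fin.lt_def.2 ha) hab hbc
    have hb1' : a.val < (Q.1.partner b).val := hb1
    have hb2' : (Q.1.partner b).val < (Q.1.partner a).val := hb2
    have hbv : b.val = a.val + 1 := rfl
    have hbb : (Q.1.partner b).val ≠ b.val := fun e => Q.1.partner_ne b (Fin.ext e)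
    have hblt : b < Q.1.partner b := by rw [Fin.lt_def]; omega
    have := hmin b (Finset.mem_filter.2 ⟨Finset.mem_univ _, hblt⟩)
    change (Q.1.partner a).val - a.val ≤ (Q.1.partner b).val - b.val at this
    omega
  have hj : a.val < n + 1 := by have := (Q.1.partner a).2; omega
  refine ⟨⟨a.val, hj⟩, ?_⟩
  have e1 : Fin.castSucc (⟨a.val, hj⟩ : Fin (n + 1)) = a := Fin.ext rfl
  rw [e1]
  exact Fin.ext (by rw [Fin.val_succ, hw])

/-- **a pattern pairing `j` with `j + 1` is the cap insertion at `j` of its contraction.** [cite: PearceRittenbergDeGierNienhuis2002, §2 (monoid)] -/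
theorem eq_capIns_contractSucc (Q : LinkPattern (n + 1 + 1)) {j : Fin (n + 1)} (h : Q.1.partner (Fin.castSucc j) = j.succ) :
    Q = (Q.contractSucc j).capIns j := by
  rw [LinkPattern.capIns_contractSucc, LinkPattern.connectSucc_of_partner_eq Q h]

/-- ★ **every link pattern of `n + 2` sites is a cap insertion** `capIns j P`. [cite: PearceRittenbergDeGierNienhuis2002, §2 (non-intersecting half-loops)] -/
theorem exists_eq_capIns (Q : LinkPattern (n + 1 + 1)) : ∃ (j : Fin (n + 1)) (P : LinkPattern n), Q = P.capIns j := by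
  obtain ⟨j, hj⟩ := Q.exists_adjacent
  exact ⟨j, Q.contractSucc j, Q.eq_capIns_contractSucc hj⟩

end LinkPattern

/-! ### The planar module is the sum of the images of the cap insertions -/

section CapSpan

variable {R : Type*} [CommRing R] {n : ℕ}

/-- a subspace containing every basis vector is everything (any number of sites). [cite: PearceRittenbergDeGierNienhuis2002, §2 (link patterns as a basis)] -/
theorem eq_top_of_forall_single_mem' {W : Submodule R (LinkPattern n →₀ R)} (h : ∀ Q, Finsupp.single Q (1 : R) ∈ W) : W = ⊤ := by
  rw [eq_top_iff]
  intro x hx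
  clear hx
  induction x using Finsupp.induction_linear with
  | zero => exact W.zero_mem
  | add x y hx hy => exact W.add_mem hx hy
  | single Q c =>
    rw [← Finsupp.smul_single_one]
    exact W.smul_mem c (h Q)

/-- ★★ **a subspace of the planar module of `n + 2` sites containing the image of every cap insertion `capInsL j` is everything.**
[cite: PearceRittenbergDeGierNienhuis2002, §2 (non-intersecting half-loops)] -/
theorem eq_top_of_forall_range_capInsL_le {W : Submodule R (LinkPattern (n + 1 + 1) →₀ R)} (h : ∀ j : Fin (n + 1), LinearMap.range (capInsL R j) ≤ W) : W = ⊤ := by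
  refine eq_top_of_forall_single_mem' fun Q => ?_
  obtain ⟨j, P, rfl⟩ := Q.exists_eq_capIns
  refine h j ⟨Finsupp.single P 1, ?_⟩
  rw [capInsL_single]

/-- ★★ **THE PLANAR MODULE IS THE SUM OF THE IMAGES OF THE CAP INSERTIONS**: `⨆_j range (capInsL j) = ⊤`. [cite: PearceRittenbergDeGierNienhuis2002, §2 (non-intersecting half-loops)] -/
theorem iSup_range_capInsL_eq_top : (⨆ j : Fin (n + 1), LinearMap.range (capInsL R j (n := n))) = ⊤ :=
  eq_top_of_forall_range_capInsL_le fun j => le_iSup (fun j : Fin (n + 1) => LinearMap.range (capInsL R j (n := n))) j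

/-- ★★★ **THE INDUCTIVE SPANNING CRITERION**: if for every `j` a family `g j` spans the planar module of `n` sites and the cap insertions `capInsL j (g j k)` all lie in the span of a
family `f` of vectors of the module of `n + 2` sites, then `f` spans it. [cite: PearceRittenbergDeGierNienhuis2002, §2 (non-intersecting half-loops; the monoid move)] -/
theorem span_eq_top_of_capInsL_mem_span {ι : Type*} {κ : Fin (n + 1) → Type*} (f : ι → LinkPattern (n + 1 + 1) →₀ R) (g : ∀ j : Fin (n + 1), κ j → (LinkPattern n →₀ R))
    (hg : ∀ j, Submodule.span R (Set.range (g j)) = ⊤) (hf : ∀ j k, capInsL R j (g j k) ∈ Submodule.span R (Set.range f)) :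
    Submodule.span R (Set.range f) = ⊤ := by
  refine eq_top_of_forall_range_capInsL_le fun j => ?_
  rintro _ ⟨x, rfl⟩
  have hx : x ∈ Submodule.span R (Set.range (g j)) := by rw [hg j]; exact Submodule.mem_top
  refine Submodule.span_induction ?_ ?_ ?_ ?_ hx
  · rintro _ ⟨k, rfl⟩; exact hf j k
  · rw [map_zero]; exact Submodule.zero_mem _
  · intro x y _ _ hx hy; rw [map_add]; exact Submodule.add_mem _ hx hy
  · intro c x _ hx; rw [map_smul]; exact Submodule.smul_mem _ c hx

end CapSpan

end Literature.Probability.LatticeModels.TemperleyLieb
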